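import Literature.NumberTheory.Automorphic.UnitaryGroupCohomologicalForms
import Summits.HodgeConjecture.HodgeConjecture.Theorems.H413SpectrumJunction
import HarnessLib

/-!
# FLOOR-0 P2, (D)-desk sub-line `F0_P2SpectralProjectionD` — STUB (T) CLOSED: pointwise invariances from the a.e. ones
# («the regular representative of a projected pair IS a holomorphic cotangent form»)

Cell hodgecm-mathlib, FLOOR 0, crux item H413 = stmt-HodgeConjecture-24833 (route `HCCMUnconditional`); sub-line
`Cruxes/H413/Lines/F0_P2SpectralProjectionD.lean` v1.1 (F0P2-plan (g2), sha16 e1fa5bd1360092b6), registered stub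
`stub_T_memHolCotFormsOfAe : StubTMemHolCotFormsOfAe` (§1 there, size M−).  PROOF lane (theorems only — no definition, no
instance, no notation, no named fact, no `sorry`); author F0P2-p02 (g2).  Per the cell's stub-closer protocol (s347/s380b) the
Lines module is NOT imported: the type of `stubT_holds` is the body of `…F0P2SpectralProjectionD.StubTMemHolCotFormsOfAe`
BINDER FOR BINDER with the Lines-local bundles unfolded — `G3 L H` ↦ `adelicGroupData L⁺ L c̄ 3 H`, and the STRUCTURE
`Realises 𝒢 μ ιinf (Ψ j) (w j)` ↦ the nested conjunction of its six fields in declaration order (`leftInv ∧ cont ∧ aeEq ∧ diff ∧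
contDeriv ∧ derivAe`, with `probeP` / `orbitP` unfolded) — so the line's fold is the one-liner
`theorem stub_T_memHolCotFormsOfAe : StubTMemHolCotFormsOfAe := fun L _ _ _ ι H T hT μ _ w Ψ hΨ =>
  F0P2dStubT.stubT_holds L ι H T hT μ w Ψ fun j => ⟨(hΨ j).leftInv, (hΨ j).cont, (hΨ j).aeEq, (hΨ j).diff, (hΨ j).contDeriv, (hΨ j).derivAe⟩`.
The mathematically honest form `memHolCotForms_of_ae` uses only the three fields `leftInv`, `cont`, `aeEq` of `Realises`
(no differentiability), for reuse by the (E)-desk and P3.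

## Content (all bookkeeping; [BorelJacquet1979, §4.2]; [Borel1997, §5.14])
* §1 (generic adelic group datum `𝒢`, `μ` invariant and positive on opens) **pointwise transport from `L²`**: if `Φ`, `Φ'` are
  CONTINUOUS left-`A_G·G(K)`-invariant functions on `G(𝔸_K)` descending a.e. to the `L²` classes `w`, `w'`, and `R(a) w = w'` for the
  tree's regular representation (`(R a f)(y) = f(a⁻¹ • y)`, ★ `rightRegular_apply_coeFn`), then `Φ (x a) = Φ' x` for EVERY `x`
  (`apply_mul_right_eq_of_rightRegular_eq`): the class of `x ↦ Φ(x a)` is `R(a)[Φ]` (★ `SpectrumJunction.toQuotFun_mul_right_apply`,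
  `measurePreserving_smul`), two continuous functions on the quotient that agree a.e. agree (Mathlib `Continuous.ae_eq_iff_eq`,
  `IsOpenPosMeasure`), and a left-invariant function is recovered from its descent (★ `SpectrumJunction.apply_eq_toQuotFun`).
* §2 (T) at the engine datum `U(H)`, `H ∈ M₃(L)`, `L` CM: from continuous left-invariant representatives `Ψ_j` of classes `w_j` carrying
  the `L²`-level right `K_c`-invariance, right invariance under an open `K_f ≤ U(H)(𝔸_{L⁺,f})` and the cotangent `K_∞`-type relation
  `R(ιinf k) w_j = Σ_i (τ k⁻¹ e_i)_j • w_i` (`τ = weightOf x₀`), plus `IsHolGerm`, the `ℂ²`-valued `x ↦ (Ψ_0 x, Ψ_1 x)` lies in ★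
  `holCotForms` (★ `mem_holCotForms_iff`: left `U(H)(L⁺)`-invariance via ★ `quotientSubgroup_adelicGroupData`; `weightForms` type clause,
  `K_c`-clause and `smoothFun` (one open `K_f`, `Submodule.mem_iSup_of_mem`, `Representation.mem_invariants`) by §1).

HC_CM is proved only modulo the printed citations until rung 0 closes; this file closes ONE bookkeeping stub (T) of ONE floor-0
sub-line and uses no printed citation as a hypothesis.

## References
* [BorelJacquet1979] A. Borel, H. Jacquet, *Automorphic forms and automorphic representations*, PSPM 33.1 (1979), §4.2, §4.6.
* [Borel1997] A. Borel, *Automorphic forms on SL₂(ℝ)*, Cambridge Tracts 130 (1997), §5.14.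
* Tree: ★ `Literature/NumberTheory/Automorphic/UnitaryGroupCohomologicalForms` (`holCotForms`, `mem_holCotForms_iff`, `smoothFun`,
  `rightRep`, `IsHolGerm`, `toQuotFun`, `cmArchSection`, `cmCompactFactor`), ★ `AutomorphicSpectrum` (`rightRegular_apply_coeFn`),
  ★ `Theorems/H413SpectrumJunction` (`toQuotFun` calculus); Mathlib `Continuous.ae_eq_iff_eq`, `measurePreserving_smul`,
  `Lp.coeFn_add`, `Lp.coeFn_smul`, `pi_eq_sum_univ'`.
-/

set_option autoImplicit false

-- the mandated namespace has the single-problem summit's repeated segment (`HodgeConjecture.HodgeConjecture`)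
set_option linter.dupNamespace false

noncomputable section

namespace Summit.HodgeConjecture.HodgeConjecture.Cruxes.H413.F0P2dStubT

open MeasureTheory NumberField MulAction
open scoped Matrix ComplexOrder
open Literature.NumberTheory.Automorphic Literature.NumberTheory.Automorphic.UnitaryGroup
open Literature.NumberTheory.Automorphic.UnitaryGroup.CotangentForms
open Literature.AlgebraicGeometry.ShimuraVarieties
open Literature.Geometry.ComplexHyperbolic.BallModel (U21 x₀)
open Summit.HodgeConjecture.HodgeConjecture.Cruxes.H413.SpectrumJunction

/-! ## §1 Pointwise transport from `L²`: continuous left-invariant representatives and the regular representation -/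

section Generic

variable {K : Type} [Field K] [NumberField K] {𝒢 : AdelicGroupData.{0} K}
  {μ : Measure 𝒢.automorphicQuotient} [SMulInvariantMeasure 𝒢.Adelic 𝒢.automorphicQuotient μ] [μ.IsOpenPosMeasure]

/-- **Pointwise transport from `L²`.**  Let `Φ`, `Φ'` be continuous left-`A_G · G(K)`-invariant functions on `G(𝔸_K)` whose descents
to the automorphic quotient are a.e. equal to the `L²` classes `w`, `w'`, and suppose `R(a) w = w'` for the regular representation
(`(R a f)(y) = f (a⁻¹ • y)`).  Then `Φ (x · a) = Φ' x` for EVERY `x ∈ G(𝔸_K)` — two continuous functions on the quotient agreeing a.e.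
agree, the measure being positive on non-empty open sets. [cite: BorelJacquet1979, §4.2 and §4.6] -/
theorem apply_mul_right_eq_of_rightRegular_eq {Φ Φ' : 𝒢.Adelic → ℂ}
    (hΦ : ∀ γ ∈ 𝒢.quotientSubgroup, ∀ g, Φ (γ * g) = Φ g) (hc : Continuous Φ)
    (hΦ' : ∀ γ ∈ 𝒢.quotientSubgroup, ∀ g, Φ' (γ * g) = Φ' g) (hc' : Continuous Φ')
    {w w' : 𝒢.L2 μ} (hw : toQuotFun 𝒢 Φ =ᵐ[μ] (w : 𝒢.automorphicQuotient → ℂ))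
    (hw' : toQuotFun 𝒢 Φ' =ᵐ[μ] (w' : 𝒢.automorphicQuotient → ℂ))
    {a : 𝒢.Adelic} (h : 𝒢.rightRegular μ a w = w') (x : 𝒢.Adelic) : Φ (x * a) = Φ' x := by
  have h1 : toQuotFun 𝒢 (fun x => Φ (x * a)) =ᵐ[μ] toQuotFun 𝒢 Φ' := by
    have h2 := 𝒢.rightRegular_apply_coeFn μ a w
    rw [h] at h2
    have h3 : (fun y => (w : 𝒢.automorphicQuotient → ℂ) (a⁻¹ • y)) =ᵐ[μ] fun y => toQuotFun 𝒢 Φ (a⁻¹ • y) :=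
      (measurePreserving_smul a⁻¹ μ).quasiMeasurePreserving.ae_eq_comp hw.symm
    have h4 : toQuotFun 𝒢 (fun x => Φ (x * a)) = fun y => toQuotFun 𝒢 Φ (a⁻¹ • y) :=
      funext fun y => toQuotFun_mul_right_apply hΦ a y
    rw [h4]
    exact (h3.symm.trans h2.symm).trans hw'.symm
  have hcont : Continuous (toQuotFun 𝒢 fun x => Φ (x * a)) :=
    continuous_toQuotFun (leftInvariant_mul_right hΦ a) (hc.comp (continuous_id.mul continuous_const))
  have heq : toQuotFun 𝒢 (fun x => Φ (x * a)) = toQuotFun 𝒢 Φ' :=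
    (Continuous.ae_eq_iff_eq μ hcont (continuous_toQuotFun hΦ' hc')).mp h1
  calc Φ (x * a) = toQuotFun 𝒢 (fun x => Φ (x * a)) (𝒢.toAutomorphicQuotient x⁻¹) :=
        apply_eq_toQuotFun (Φ := fun x => Φ (x * a)) (leftInvariant_mul_right hΦ a) x
    _ = toQuotFun 𝒢 Φ' (𝒢.toAutomorphicQuotient x⁻¹) := by rw [heq]
    _ = Φ' x := (apply_eq_toQuotFun hΦ' x).symm

/-- **Pointwise invariance from `L²` invariance**: a continuous left-invariant representative `Φ` of a class `w` with `R(a) w = w` is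
right-`a`-invariant everywhere, `Φ (x · a) = Φ x`. [cite: BorelJacquet1979, §4.2 and §4.6] -/
theorem apply_mul_right_eq_self_of_rightRegular_eq_self {Φ : 𝒢.Adelic → ℂ}
    (hΦ : ∀ γ ∈ 𝒢.quotientSubgroup, ∀ g, Φ (γ * g) = Φ g) (hc : Continuous Φ)
    {w : 𝒢.L2 μ} (hw : toQuotFun 𝒢 Φ =ᵐ[μ] (w : 𝒢.automorphicQuotient → ℂ))
    {a : 𝒢.Adelic} (h : 𝒢.rightRegular μ a w = w) (x : 𝒢.Adelic) : Φ (x * a) = Φ x :=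
  apply_mul_right_eq_of_rightRegular_eq hΦ hc hΦ hc hw hw h x

omit [SMulInvariantMeasure 𝒢.Adelic 𝒢.automorphicQuotient μ] [μ.IsOpenPosMeasure] in
/-- The descent of a finite linear combination of two continuous left-invariant representatives is a.e. the same combination of
the classes: `toQuotFun (x ↦ c₀ Φ₀ x + c₁ Φ₁ x) =ᵐ c₀ • w₀ + c₁ • w₁` read through `Fin 2`-sums (Mathlib `Lp.coeFn_add`,
`Lp.coeFn_smul`). [cite: BorelJacquet1979, §4.6] -/
theorem toQuotFun_sum_two_ae_eq (Φ : Fin 2 → (𝒢.Adelic → ℂ)) (w : Fin 2 → 𝒢.L2 μ)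
    (hw : ∀ i, toQuotFun 𝒢 (Φ i) =ᵐ[μ] (w i : 𝒢.automorphicQuotient → ℂ)) (c : Fin 2 → ℂ) :
    toQuotFun 𝒢 (fun x => ∑ i : Fin 2, c i * Φ i x) =ᵐ[μ]
      ((∑ i : Fin 2, c i • w i : 𝒢.L2 μ) : 𝒢.automorphicQuotient → ℂ) := by
  have hsum : toQuotFun 𝒢 (fun x => ∑ i : Fin 2, c i * Φ i x) =
      fun y => c 0 * toQuotFun 𝒢 (Φ 0) y + c 1 * toQuotFun 𝒢 (Φ 1) y := by
    funext y
    simp only [toQuotFun, Fin.sum_univ_two]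
  rw [hsum, Fin.sum_univ_two]
  have h0 := Lp.coeFn_smul (c 0) (w 0)
  have h1 := Lp.coeFn_smul (c 1) (w 1)
  have hadd := Lp.coeFn_add (c 0 • w 0) (c 1 • w 1)
  filter_upwards [hw 0, hw 1, h0, h1, hadd] with y hy0 hy1 hy0' hy1' hy
  rw [hy, Pi.add_apply, hy0', hy1', Pi.smul_apply, Pi.smul_apply, smul_eq_mul, smul_eq_mul, hy0, hy1]

end Generic

/-! ## §2 (T) at the engine datum: the regular representative is a holomorphic cotangent form -/

section Engine

variable (L : Type) [Field L] [NumberField L] [IsCMField L] (ι : L →+* ℂ) (H : Matrix (Fin 3) (Fin 3) L) (T : GL (Fin 3) ℂ)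
  (hT : (T : Matrix (Fin 3) (Fin 3) ℂ)ᴴ * H.map ι * (T : Matrix (Fin 3) (Fin 3) ℂ) = Literature.Geometry.ComplexHyperbolic.BallModel.J)
  (μ : Measure (adelicGroupData (↥(maximalRealSubfield L)) L (IsCMField.complexConj L) 3 H).automorphicQuotient)
  [(adelicGroupData (↥(maximalRealSubfield L)) L (IsCMField.complexConj L) 3 H).IsAutomorphicMeasure μ]

/-- **(T), honest form — pointwise invariances from the a.e. ones.**  At the engine datum `U(H)` (`H ∈ M₃(L)`, `L` CM, frame `T` at
`ι`, `μ` automorphic): if `Ψ_j` (`j = 0,1`) are CONTINUOUS left-`A_G · U(H)(L⁺)`-invariant functions on `U(H)(𝔸_{L⁺})` whose descents are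
a.e. the `L²` classes `w_j`, and the pair `w` is `L²`-invariant under right `K_c = cmCompactFactor`, under an OPEN `K_f ≤ U(H)(𝔸_{L⁺,f})`,
and satisfies the cotangent `K_∞`-type relation `R(ιinf k) w_j = Σ_i (τ k⁻¹ e_i)_j • w_i` (`ιinf = cmArchSection`, `τ = weightOf x₀`),
and `x ↦ (Ψ_0 x, Ψ_1 x)` has holomorphic germs along `ιinf`, then `x ↦ (Ψ_0 x, Ψ_1 x) ∈ holCotForms` (★ `mem_holCotForms_iff`; every
a.e. identity becomes a pointwise one by `apply_mul_right_eq_of_rightRegular_eq`). [cite: BorelJacquet1979, §4.2] [cite: Borel1997, §5.14] -/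
theorem memHolCotForms_of_ae
    (w : Fin 2 → (adelicGroupData (↥(maximalRealSubfield L)) L (IsCMField.complexConj L) 3 H).L2 μ)
    (Ψ : Fin 2 → ((adelicGroupData (↥(maximalRealSubfield L)) L (IsCMField.complexConj L) 3 H).Adelic → ℂ))
    (hleft : ∀ j, ∀ γ ∈ (adelicGroupData (↥(maximalRealSubfield L)) L (IsCMField.complexConj L) 3 H).quotientSubgroup,
      ∀ x, Ψ j (γ * x) = Ψ j x)
    (hcont : ∀ j, Continuous (Ψ j))
    (hae : ∀ j, toQuotFun (adelicGroupData (↥(maximalRealSubfield L)) L (IsCMField.complexConj L) 3 H) (Ψ j) =ᵐ[μ]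
      (w j : (adelicGroupData (↥(maximalRealSubfield L)) L (IsCMField.complexConj L) 3 H).automorphicQuotient → ℂ))
    (hkc : ∀ k ∈ cmCompactFactor L ι H T hT, ∀ j,
      (adelicGroupData (↥(maximalRealSubfield L)) L (IsCMField.complexConj L) 3 H).rightRegular μ k (w j) = w j)
    (hkf : ∃ Kf : Subgroup (finAdelic (↥(maximalRealSubfield L)) L (IsCMField.complexConj L) 3 H),
      IsOpen (Kf : Set (finAdelic (↥(maximalRealSubfield L)) L (IsCMField.complexConj L) 3 H)) ∧
        ∀ k ∈ Kf, ∀ j,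
          (adelicGroupData (↥(maximalRealSubfield L)) L (IsCMField.complexConj L) 3 H).rightRegular μ
            (finAdelicToAdelic (↥(maximalRealSubfield L)) L (IsCMField.complexConj L) 3 H k) (w j) = w j)
    (hktype : ∀ (k : stabilizer (↥U21) x₀) (j : Fin 2),
      (adelicGroupData (↥(maximalRealSubfield L)) L (IsCMField.complexConj L) 3 H).rightRegular μ
          (cmArchSection L ι H T hT k) (w j) =
        ∑ i : Fin 2, (BallForms.isPullbackCocycle_cotangentCocycle.weightOf x₀ k⁻¹ (Pi.single i 1)) j • w i)
    (hgerm : IsHolGerm (cmArchSection L ι H T hT) (fun x j => Ψ j x)) :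
    (fun x j => Ψ j x) ∈ holCotForms (↥(maximalRealSubfield L)) L (IsCMField.complexConj L) 3 H (cmArchSection L ι H T hT)
      (cmCompactFactor L ι H T hT) := by
  rw [mem_holCotForms_iff]
  refine ⟨⟨fun γ hγ g => ?_, fun k g => ?_⟩, fun k hk x => ?_, ?_, hgerm⟩
  · -- left `U(H)(L⁺)`-invariance
    funext j
    refine hleft j γ ?_ g
    rw [quotientSubgroup_adelicGroupData]
    exact hγ
  · -- the cotangent `K_∞`-type relation along `ιinf ∘ Stab(x₀)`
    funext j
    have hcomb : ∀ x, Ψ j (x * cmArchSection L ι H T hT k) =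
        ∑ i : Fin 2, (BallForms.isPullbackCocycle_cotangentCocycle.weightOf x₀ k⁻¹ (Pi.single i 1)) j * Ψ i x := by
      refine apply_mul_right_eq_of_rightRegular_eq (hleft j) (hcont j) (fun γ hγ g => ?_) ?_ (hae j)
        (toQuotFun_sum_two_ae_eq Ψ w hae _) (hktype k j)
      · simp only [hleft _ γ hγ g]
      · exact continuous_finsetSum _ fun i _ => continuous_const.mul (hcont i)
    rw [MonoidHom.comp_apply, Subgroup.subtype_apply]
    dsimp only
    rw [hcomb g]
    have hv : (fun j => Ψ j g) = ∑ i : Fin 2, Ψ i g • (Pi.single i 1 : Fin 2 → ℂ) := pi_eq_sum_univ' _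
    rw [hv, map_sum, Finset.sum_apply]
    refine Finset.sum_congr rfl fun i _ => ?_
    rw [map_smul, Pi.smul_apply, smul_eq_mul, mul_comm]
  · -- right `K_c`-invariance
    funext j
    exact apply_mul_right_eq_self_of_rightRegular_eq_self (hleft j) (hcont j) (hae j) (hkc k hk j) x
  · -- smoothness under `U(H)(𝔸_{L⁺,f})`: one open `K_f`
    obtain ⟨Kf, hopen, hKf⟩ := hkf
    refine Submodule.mem_iSup_of_mem Kf (Submodule.mem_iSup_of_mem hopen ?_)
    rw [Representation.mem_invariants]
    intro k
    funext x j
    rw [MonoidHom.comp_apply, Subgroup.subtype_apply, rightRep_apply]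
    exact apply_mul_right_eq_self_of_rightRegular_eq_self (hleft j) (hcont j) (hae j) (hKf k k.2 j) x

/-- **(T) — the registered stub `stub_T_memHolCotFormsOfAe : StubTMemHolCotFormsOfAe` of `Lines/F0_P2SpectralProjectionD.lean`,
BODY VERBATIM** with the Lines-local bundles unfolded (`G3`, and the structure `Realises` as the nested conjunction of its six fields
`leftInv ∧ cont ∧ aeEq ∧ diff ∧ contDeriv ∧ derivAe` with `probeP` / `orbitP` unfolded); only `leftInv`, `cont`, `aeEq` are used
(`memHolCotForms_of_ae`).  Fold: `fun L _ _ _ ι H T hT μ _ w Ψ hΨ => stubT_holds L ι H T hT μ w Ψ fun j =>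
⟨(hΨ j).leftInv, (hΨ j).cont, (hΨ j).aeEq, (hΨ j).diff, (hΨ j).contDeriv, (hΨ j).derivAe⟩`. [cite: BorelJacquet1979, §4.2]
[cite: Borel1997, §5.14] -/
theorem stubT_holds :
    ∀ (L : Type) [Field L] [NumberField L] [IsCMField L] (ι : L →+* ℂ) (H : Matrix (Fin 3) (Fin 3) L) (T : GL (Fin 3) ℂ)
    (hT : (T : Matrix (Fin 3) (Fin 3) ℂ)ᴴ * H.map ι * (T : Matrix (Fin 3) (Fin 3) ℂ) = Literature.Geometry.ComplexHyperbolic.BallModel.J)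
    (μ : Measure (adelicGroupData (↥(maximalRealSubfield L)) L (IsCMField.complexConj L) 3 H).automorphicQuotient)
      [(adelicGroupData (↥(maximalRealSubfield L)) L (IsCMField.complexConj L) 3 H).IsAutomorphicMeasure μ]
    (w : Fin 2 → (adelicGroupData (↥(maximalRealSubfield L)) L (IsCMField.complexConj L) 3 H).L2 μ)
    (Ψ : Fin 2 → ((adelicGroupData (↥(maximalRealSubfield L)) L (IsCMField.complexConj L) 3 H).Adelic → ℂ)),
      (∀ j,
        (∀ γ ∈ (adelicGroupData (↥(maximalRealSubfield L)) L (IsCMField.complexConj L) 3 H).quotientSubgroup,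
            ∀ x, Ψ j (γ * x) = Ψ j x) ∧
          Continuous (Ψ j) ∧
          toQuotFun (adelicGroupData (↥(maximalRealSubfield L)) L (IsCMField.complexConj L) 3 H) (Ψ j) =ᵐ[μ]
              (w j : (adelicGroupData (↥(maximalRealSubfield L)) L (IsCMField.complexConj L) 3 H).automorphicQuotient → ℂ) ∧
          (∀ y, DifferentiableAt ℝ (fun b : Fin 2 → ℂ => Ψ j (y * cmArchSection L ι H T hT (BallForms.expP b))) 0) ∧
          (∀ b : Fin 2 → ℂ,
              Continuous fun y => fderiv ℝ (fun b : Fin 2 → ℂ => Ψ j (y * cmArchSection L ι H T hT (BallForms.expP b))) 0 b) ∧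
          ∀ b : Fin 2 → ℂ,
            toQuotFun (adelicGroupData (↥(maximalRealSubfield L)) L (IsCMField.complexConj L) 3 H)
                (fun y => fderiv ℝ (fun b : Fin 2 → ℂ => Ψ j (y * cmArchSection L ι H T hT (BallForms.expP b))) 0 b) =ᵐ[μ]
              ((fderiv ℝ
                    (fun b : Fin 2 → ℂ =>
                      (adelicGroupData (↥(maximalRealSubfield L)) L (IsCMField.complexConj L) 3 H).rightRegular μ
                        (cmArchSection L ι H T hT (BallForms.expP b)) (w j))
                    0 b :
                  (adelicGroupData (↥(maximalRealSubfield L)) L (IsCMField.complexConj L) 3 H).L2 μ) :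
                (adelicGroupData (↥(maximalRealSubfield L)) L (IsCMField.complexConj L) 3 H).automorphicQuotient → ℂ)) →
      (∀ k ∈ cmCompactFactor L ι H T hT, ∀ j,
        (adelicGroupData (↥(maximalRealSubfield L)) L (IsCMField.complexConj L) 3 H).rightRegular μ k (w j) = w j) →
      (∃ Kf : Subgroup (finAdelic (↥(maximalRealSubfield L)) L (IsCMField.complexConj L) 3 H),
        IsOpen (Kf : Set (finAdelic (↥(maximalRealSubfield L)) L (IsCMField.complexConj L) 3 H)) ∧
          ∀ k ∈ Kf, ∀ j,
            (adelicGroupData (↥(maximalRealSubfield L)) L (IsCMField.complexConj L) 3 H).rightRegular μ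
              (finAdelicToAdelic (↥(maximalRealSubfield L)) L (IsCMField.complexConj L) 3 H k) (w j) = w j) →
      (∀ (k : stabilizer (↥U21) x₀) (j : Fin 2),
        (adelicGroupData (↥(maximalRealSubfield L)) L (IsCMField.complexConj L) 3 H).rightRegular μ
            (cmArchSection L ι H T hT k) (w j) =
          ∑ i : Fin 2, (BallForms.isPullbackCocycle_cotangentCocycle.weightOf x₀ k⁻¹ (Pi.single i 1)) j • w i) →
      IsHolGerm (cmArchSection L ι H T hT) (fun x j => Ψ j x) →
        (fun x j => Ψ j x) ∈ holCotForms (↥(maximalRealSubfield L)) L (IsCMField.complexConj L) 3 H (cmArchSection L ι H T hT)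
          (cmCompactFactor L ι H T hT) :=
  fun L _ _ _ ι H T hT μ _ w Ψ hΨ hkc hkf hktype hgerm =>
    memHolCotForms_of_ae L ι H T hT μ w Ψ (fun j => (hΨ j).1) (fun j => (hΨ j).2.1) (fun j => (hΨ j).2.2.1) hkc hkf hktype
      hgerm

end Engine

end Summit.HodgeConjecture.HodgeConjecture.Cruxes.H413.F0P2dStubT

end
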